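import Literature.AlgebraicGeometry.Resolution.CurveSmoothingDescent
import Mathlib.FieldTheory.Relrank
import HarnessLib

/-!
# Descent of smoothness from the perfect closure: stabilization along an algebraic tower

Topic: `Literature/AlgebraicGeometry/Resolution`. Third step of the tree's programme to
discharge the named fact `Temkin2013CurveSmoothing` (Görtz–Wedhorn, *Algebraic Geometry II*,
Lemma 26.43 (1), in the affine form used by M. Temkin, *Inseparable local uniformization*,
J. Algebra 373 (2013), proof of Thm. 3.3.1, Step 1), after `NormalCurvesOverPerfectFields.lean`
(the perfect case) and `CurveSmoothingDescent.lean` (the algebraic lemmas). Görtz–Wedhorn's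
proof comes down from the perfect closure `k'` of the ground field to a finite purely
inseparable extension by "a standard limit argument" (p. 706). To run that argument through
faithfully flat descent of smoothness (`CurveSmoothing.smooth_of_linearDisjoint_of_sup_eq`) one
needs a finite level `l` of the tower `k ⊆ l ⊆ k'` such that `k'` and the function field
`lK` are LINEARLY DISJOINT over `l` (then `k' ⊗ₗ lK = k'K`). This file PROVES the existence of
such a level for any one-dimensional function field `K = k(t, g₁, …, gₙ)` (with `t`
transcendental over `k`, the `gᵢ` algebraic over `k(t)`) and any algebraic extension `kalg` of
`k` inside an ambient field `Ω`, WITHOUT separability theory, by a stabilization argument: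

* `CurveSmoothing.exists_level_linearDisjoint` — there is a finite subextension `l₀ ⊆ kalg`
  such that for every finite level `l₀ ⊆ l ⊆ kalg`, `kalg` and `lK = K ⊔ l` are linearly
  disjoint over `l` (as `l`-subalgebras of `Ω`). Proof: the degree `d(l) = [lK : l(t)]` is
  finite and can only drop when `l` grows (`finrank_adjoin_le_finrank`); choose `l₀`
  minimizing it. For finite levels `l₀ ⊆ l ⊆ l'`, `[l'K : l(t)] = [l'K : l'(t)]·[l'(t) : l(t)]
  = d(l)·[l'(t) : l(t)]`, so `l'(t)` and `lK` are linearly disjoint over `l(t)`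
  (`IntermediateField.LinearDisjoint.of_finrank_sup`); as `l'` and `l(t)` are linearly disjoint
  over `l` (`linearDisjoint_adjoin_simple_of_transcendental`), `l'` and `lK` are linearly
  disjoint over `l` (`linearDisjoint_of_linearDisjoint_adjoin`), and `kalg` is the directed union
  of such `l'` (`Subalgebra.LinearDisjoint.of_linearDisjoint_finite_left`).
* `CurveSmoothing.finrank_eq_of_coe_eq` — degrees do not depend on the presentation of a tower
  of subfields of `Ω` (bookkeeping between `l(t)` seen over `l` and over `k`);
  `CurveSmoothing.finrank_adjoin_le_finrank` — `[E'(L) : E'] ≤ [L : F]`;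
  `CurveSmoothing.linearDisjoint_restrict`, `isAlgebraic_of_le`, `isAlgebraic_extend` — glue.

## Sources

* U. Görtz, T. Wedhorn, *Algebraic Geometry II*, Springer (2023), Lemma 26.43 (1) and its proof
  (p. 706, "standard limit argument").
* M. Temkin, *Inseparable local uniformization*, J. Algebra 373 (2013) 65–119 =
  arXiv:0804.1554v3, proof of Thm. 3.3.1, Step 1 (pp. 44–45).
-/

noncomputable section

open scoped IntermediateField

namespace Literature.AlgebraicGeometry.Resolution

namespace CurveSmoothing

universe u

variable {k : Type u} {Ω : Type u} [Field k] [Field Ω] [Algebra k Ω]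

/-! ### Comparing degrees across two presentations of the same fields -/

/-- Two presentations of the same extension of subfields of `Ω` have the same degree.
[folklore] -/
theorem finrank_eq_of_coe_eq {K₁ K₂ : Type*} [Field K₁] [Field K₂] [Algebra K₁ Ω] [Algebra K₂ Ω]
    (e : K₁ ≃+* K₂) (he : ∀ x, algebraMap K₂ Ω (e x) = algebraMap K₁ Ω x)
    (E₁ : IntermediateField K₁ Ω) (E₂ : IntermediateField K₂ Ω) (hE : (E₁ : Set Ω) = E₂) :
    Module.finrank K₁ E₁ = Module.finrank K₂ E₂ := by
  have hE' : E₁.toSubring = E₂.toSubring := SetLike.ext' hE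
  let j : E₁ ≃+* E₂ := RingEquiv.subringCongr hE'
  have hj : ∀ x : E₁, (j x : Ω) = x := fun x => rfl
  refine Algebra.finrank_eq_of_equiv_equiv e j ?_
  ext x
  change (algebraMap K₂ E₂ (e x) : Ω) = (j (algebraMap K₁ E₁ x) : Ω)
  rw [hj]
  exact he x

/-! ### Degrees can only drop when the base grows -/

/-- `[E'(L) : E'] ≤ [L : F]` for a tower `F ⊆ E' ⊆ Ω` and a finite extension `L/F` inside `Ω`
(finite-rank form of `IntermediateField.adjoin_rank_le_of_isAlgebraic`). [folklore] -/
theorem finrank_adjoin_le_finrank {F : Type*} [Field F] [Algebra F Ω] (E' : Type*) [Field E']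
    [Algebra F E'] [Algebra E' Ω] [IsScalarTower F E' Ω] (L : IntermediateField F Ω)
    [FiniteDimensional F L] :
    Module.finrank E' (IntermediateField.adjoin E' (L : Set Ω)) ≤ Module.finrank F L := by
  have h := IntermediateField.adjoin_rank_le_of_isAlgebraic E' L
    (Or.inr (Algebra.IsAlgebraic.of_finite F L))
  exact Cardinal.toNat_le_toNat h (Module.rank_lt_aleph0 F L)

/-! ### The last step, isolated (restricting the right-hand side) -/

/-- From linear disjointness of `l'` and `lK` (presented over `l(t)`) to linear disjointness of
`l'` and `lK` presented over `l`. [folklore] -/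
theorem linearDisjoint_restrict {l : IntermediateField k Ω} (K : IntermediateField k Ω) {t : Ω}
    (l' : IntermediateField k Ω) (hll' : l ≤ l')
    (hMtEl : IntermediateField.adjoin l {t} ≤
      IntermediateField.extendScalars (le_sup_right : l ≤ K ⊔ l))
    (HT : (IntermediateField.extendScalars hll').toSubalgebra.LinearDisjoint
      (Subalgebra.restrictScalars l
        (IntermediateField.extendScalars hMtEl).toSubalgebra)) :
    (IntermediateField.extendScalars hll').toSubalgebra.LinearDisjoint
      (IntermediateField.extendScalars (le_sup_right : l ≤ K ⊔ l)).toSubalgebra := by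
  refine HT.of_le_right_of_flat fun x hx => ?_
  simp only [Subalgebra.mem_restrictScalars, IntermediateField.mem_toSubalgebra,
    IntermediateField.mem_extendScalars] at hx ⊢
  exact hx

/-! ### Algebraicity bookkeeping -/

omit [Algebra k Ω] in
/-- A subextension of an algebraic extension is algebraic. [folklore] -/
theorem isAlgebraic_of_le [Algebra k Ω] {l kalg : IntermediateField k Ω} (h : l ≤ kalg)
    [Algebra.IsAlgebraic k kalg] : Algebra.IsAlgebraic k l := by
  refine ⟨fun x => ?_⟩
  have hx : IsAlgebraic k ((⟨x.1, h x.2⟩ : kalg) : Ω) :=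
    IntermediateField.isAlgebraic_iff.mp (Algebra.IsAlgebraic.isAlgebraic _)
  exact IntermediateField.isAlgebraic_iff.mpr hx

/-- An intermediate field of `Ω/l` contained in an algebraic extension `kalg/k` is algebraic
over `l`. [folklore] -/
theorem isAlgebraic_extend {l kalg : IntermediateField k Ω} [Algebra.IsAlgebraic k kalg]
    (L : IntermediateField l Ω) (h : L.restrictScalars k ≤ kalg) : Algebra.IsAlgebraic l L := by
  refine ⟨fun x => ?_⟩
  have hx : IsAlgebraic k ((⟨x.1, h x.2⟩ : kalg) : Ω) :=
    IntermediateField.isAlgebraic_iff.mp (Algebra.IsAlgebraic.isAlgebraic _)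
  have hx' : IsAlgebraic l (x : Ω) := hx.extendScalars (algebraMap k l).injective
  exact IntermediateField.isAlgebraic_iff.mpr hx'

/-! ### The stabilization theorem -/

set_option maxHeartbeats 400000 in
/-- **Linear disjointness at a deep enough finite level of an algebraic tower.** Let `K ⊆ Ω` be
a one-dimensional function field over `k`: `K = k(t, g₁, …, gₙ)` with `t` transcendental over
`k` and the `gᵢ` algebraic over `k(t)`; let `kalg ⊆ Ω` be an algebraic extension of `k` (in the
application, the perfect closure of `k` in `Ω`). Then there is a finite subextension `l₀ ⊆ kalg`
such that for every finite level `l` with `l₀ ⊆ l ⊆ kalg` the fields `kalg` and `lK = K ⊔ l`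
are linearly disjoint over `l`. Proof: the degree `d(l) = [lK : l(t)]` is finite and can only
drop when `l` grows (`finrank_adjoin_le_finrank`); choose `l₀` minimizing it. For finite levels
`l₀ ⊆ l ⊆ l'`, `[l'K : l(t)] = [l'K : l'(t)]·[l'(t) : l(t)] = d(l)·[l'(t) : l(t)]`, so `l'(t)`
and `lK` are linearly disjoint over `l(t)` (`IntermediateField.LinearDisjoint.of_finrank_sup`);
since `l'` and `l(t)` are linearly disjoint over `l` (`linearDisjoint_adjoin_simple_of_transcendental`)
this gives linear disjointness of `l'` and `lK` over `l` (`linearDisjoint_of_linearDisjoint_adjoin`),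
and `kalg` is the union of such `l'` (`Subalgebra.LinearDisjoint.of_linearDisjoint_finite_left`).
[folklore] -/
theorem exists_level_linearDisjoint (K kalg : IntermediateField k Ω) [Algebra.IsAlgebraic k kalg]
    {t : Ω} (htK : t ∈ K) (ht : Transcendental k t) (genK : Finset Ω)
    (hK : IntermediateField.adjoin k (insert t (genK : Set Ω)) = K)
    (hgen : ∀ x ∈ genK, IsAlgebraic k⟮t⟯ x) :
    ∃ l₀ : IntermediateField k Ω, l₀ ≤ kalg ∧ FiniteDimensional k l₀ ∧
      ∀ (l : IntermediateField k Ω) (hl : l ≤ kalg), l₀ ≤ l → FiniteDimensional k l →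
        (IntermediateField.extendScalars hl).toSubalgebra.LinearDisjoint
          (IntermediateField.extendScalars (le_sup_right : l ≤ K ⊔ l)).toSubalgebra := by
  classical
  -- the two towers of fields attached to a level `l`: `M l = l(t)` and `EK l = lK`
  let M : IntermediateField k Ω → IntermediateField k Ω :=
    fun l => IntermediateField.adjoin k ((l : Set Ω) ∪ {t})
  let EK : IntermediateField k Ω → IntermediateField k Ω := fun l => K ⊔ l
  have hM : ∀ l, M l = IntermediateField.adjoin k ((l : Set Ω) ∪ {t}) := fun _ => rfl
  have hEK : ∀ l, EK l = K ⊔ l := fun _ => rfl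
  have hlM : ∀ l : IntermediateField k Ω, l ≤ M l :=
    fun l x hx => IntermediateField.subset_adjoin k _ (Or.inl hx)
  have htM : ∀ l, t ∈ M l := fun l => IntermediateField.subset_adjoin k _ (Or.inr rfl)
  have hME : ∀ l, M l ≤ EK l := by
    intro l
    rw [hM, IntermediateField.adjoin_le_iff]
    rintro x (hx | hx)
    · exact (le_sup_right : l ≤ K ⊔ l) hx
    · rw [Set.mem_singleton_iff] at hx
      rw [hx]
      exact (le_sup_left : K ≤ K ⊔ l) htK
  have hMmono : ∀ {l l' : IntermediateField k Ω}, l ≤ l' → M l ≤ M l' :=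
    fun h => IntermediateField.adjoin.mono k _ _ (Set.union_subset_union_left _ h)
  have hMsup : ∀ {l l' : IntermediateField k Ω}, l ≤ l' → M l ⊔ l' = M l' := by
    intro l l' h
    refine le_antisymm (sup_le (hMmono h) (hlM l')) ?_
    rw [hM l', IntermediateField.adjoin_le_iff]
    rintro x (hx | hx)
    · exact (le_sup_right : l' ≤ M l ⊔ l') hx
    · rw [Set.mem_singleton_iff] at hx
      rw [hx]
      exact (le_sup_left : M l ≤ M l ⊔ l') (htM l)
  have hEKsup : ∀ {l l' : IntermediateField k Ω}, l ≤ l' → M l' ⊔ EK l = EK l' := by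
    intro l l' h
    refine le_antisymm (sup_le (hME l') (sup_le le_sup_left (le_sup_right.trans' h))) ?_
    exact sup_le (le_sup_left.trans le_sup_right) ((hlM l').trans le_sup_left)
  -- the degree `d l = [lK : l(t)]`
  let d : IntermediateField k Ω → ℕ := fun l => (M l).relfinrank (EK l)
  have hd : ∀ l, d l = Module.finrank (M l) (IntermediateField.extendScalars (hME l)) :=
    fun l => IntermediateField.relfinrank_eq_finrank_of_le (hME l)
  -- `lK = l(t)(g₁, …, gₙ)` is finite over `l(t)`
  have hXeq : ∀ l, IntermediateField.extendScalars (hME l) =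
      IntermediateField.adjoin (M l) (genK : Set Ω) := by
    intro l
    apply IntermediateField.restrictScalars_injective k
    rw [IntermediateField.extendScalars_restrictScalars, IntermediateField.restrictScalars_adjoin,
      IntermediateField.adjoin_union, IntermediateField.adjoin_self]
    show K ⊔ l = M l ⊔ IntermediateField.adjoin k (genK : Set Ω)
    rw [hM, ← IntermediateField.adjoin_union, ← hK, ← IntermediateField.adjoin_self k l,
      ← IntermediateField.adjoin_union, IntermediateField.adjoin_self k l]
    congr 1
    ext x
    simp only [Set.mem_union, Set.mem_insert_iff, Set.mem_singleton_iff, SetLike.mem_coe]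
    tauto
  have hXfin : ∀ l, FiniteDimensional (M l) (IntermediateField.extendScalars (hME l)) := by
    intro l
    rw [hXeq l]
    refine IntermediateField.finiteDimensional_adjoin fun x hx => ?_
    have hle : k⟮t⟯ ≤ M l :=
      IntermediateField.adjoin.mono k _ _ (Set.singleton_subset_iff.mpr (Or.inr rfl))
    have halg : IsAlgebraic (M l) x :=
      (hgen x hx).ringHom_of_comp_eq (IntermediateField.inclusion hle) (RingHom.id Ω)
        (IntermediateField.inclusion hle).injective (RingHom.ext fun _ => rfl)
    exact halg.isIntegral
  have hdpos : ∀ l, 0 < d l := by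
    intro l
    haveI := hXfin l
    rw [hd]
    exact Module.finrank_pos
  -- degrees drop along the tower
  have hdmono : ∀ {l l' : IntermediateField k Ω}, l ≤ l' → d l' ≤ d l := by
    intro l l' hll'
    letI : Algebra (M l) (M l') := (IntermediateField.inclusion (hMmono hll')).toRingHom.toAlgebra
    haveI : IsScalarTower (M l) (M l') Ω := IsScalarTower.of_algebraMap_eq fun _ => rfl
    haveI := hXfin l
    have h1 := finrank_adjoin_le_finrank (F := M l) (M l') (IntermediateField.extendScalars (hME l))
    have h2 : IntermediateField.adjoin (M l')
        ((IntermediateField.extendScalars (hME l) : IntermediateField (M l) Ω) : Set Ω) =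
        IntermediateField.extendScalars (hME l') := by
      apply IntermediateField.restrictScalars_injective k
      rw [IntermediateField.restrictScalars_adjoin, IntermediateField.extendScalars_restrictScalars,
        IntermediateField.coe_extendScalars, IntermediateField.adjoin_union,
        IntermediateField.adjoin_self, IntermediateField.adjoin_self]
      exact hEKsup hll'
    rw [hd, hd, ← h2]
    exact h1
  clear hXfin
  -- a finite level of minimal degree
  have hex : ∃ n, ∃ l : IntermediateField k Ω, l ≤ kalg ∧ FiniteDimensional k l ∧ d l = n :=
    ⟨d ⊥, ⊥, bot_le, inferInstance, rfl⟩
  obtain ⟨l₀, hl₀k, hl₀fin, hdl₀⟩ := Nat.find_spec hex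
  have hmin : ∀ l : IntermediateField k Ω, l ≤ kalg → FiniteDimensional k l → d l₀ ≤ d l :=
    fun l h1 h2 => by
      rw [hdl₀]
      exact Nat.find_min' hex ⟨l, h1, h2, rfl⟩
  refine ⟨l₀, hl₀k, hl₀fin, fun l hl hl₀l hlfin => ?_⟩
  -- ### the argument at a level `l` above `l₀`
  haveI := hlfin
  haveI alg_l : Algebra.IsAlgebraic k l := isAlgebraic_of_le hl
  have htl : Transcendental l t := ht.extendScalars l
  -- `l(t)` and `lK` over the base `l`
  set Mt : IntermediateField l Ω := IntermediateField.adjoin l {t} with hMt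
  have hMt_res : Mt.restrictScalars k = M l := by
    rw [hMt, IntermediateField.restrictScalars_adjoin]
  set El : IntermediateField l Ω := IntermediateField.extendScalars (le_sup_right : l ≤ K ⊔ l)
    with hEl
  have hMtEl : Mt ≤ El := by
    rw [hMt, IntermediateField.adjoin_le_iff, Set.singleton_subset_iff]
    exact (le_sup_left : K ≤ K ⊔ l) htK
  set X : IntermediateField Mt Ω := IntermediateField.extendScalars hMtEl with hX
  have hXcoe : (X : Set Ω) = (IntermediateField.extendScalars (hME l) : Set Ω) := by
    simp only [hX, hEl, IntermediateField.coe_extendScalars]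
    rfl
  -- the identity `l(t) = l(t)` between the two presentations of the base
  have hsub : Mt.toSubring = (M l).toSubring := by
    rw [← hMt_res]
    rfl
  let e : Mt ≃+* M l := RingEquiv.subringCongr hsub
  have he : ∀ x, algebraMap (M l) Ω (e x) = algebraMap Mt Ω x := fun _ => rfl
  have hfinX : Module.finrank Mt X = d l := by
    rw [hd]
    exact finrank_eq_of_coe_eq e he X _ hXcoe
  haveI : FiniteDimensional Mt X := Module.finite_of_finrank_pos (by rw [hfinX]; exact hdpos l)
  -- ### reduce to finite subextensions `A'` of `kalg`
  haveI : Algebra.IsAlgebraic l (IntermediateField.extendScalars hl) :=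
    isAlgebraic_extend _ (by rw [IntermediateField.extendScalars_restrictScalars])
  refine Subalgebra.LinearDisjoint.of_linearDisjoint_finite_left _ _ fun A' hA' hA'fin => ?_
  -- the finite level `l'` generated by `A'`
  have hA'alg : ∀ x ∈ (A' : Set Ω), IsAlgebraic l x := by
    intro x hx
    have hx' : x ∈ kalg := hA' hx
    have : IsAlgebraic k ((⟨x, hx'⟩ : kalg) : Ω) :=
      IntermediateField.isAlgebraic_iff.mp (Algebra.IsAlgebraic.isAlgebraic _)
    exact this.extendScalars (algebraMap k l).injective
  set L' : IntermediateField l Ω := IntermediateField.adjoin l (A' : Set Ω) with hL'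
  have hL'A' : L'.toSubalgebra = A' := by
    rw [hL', IntermediateField.adjoin_toSubalgebra_of_isAlgebraic hA'alg, Algebra.adjoin_eq]
  set l' : IntermediateField k Ω := L'.restrictScalars k with hl'
  have hll' : l ≤ l' := fun x hx => L'.algebraMap_mem ⟨x, hx⟩
  have hl'k : l' ≤ kalg := by
    intro x hx
    have hx' : x ∈ L'.toSubalgebra := hx
    rw [hL'A'] at hx'
    exact hA' hx'
  haveI hl'fin : FiniteDimensional k l' := by
    haveI : Module.Finite l L' :=
      Module.Finite.equiv (Subalgebra.equivOfEq _ _ hL'A').symm.toLinearEquiv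
    have : Module.Finite k L' := Module.Finite.trans l L'
    exact this
  haveI alg_l' : Algebra.IsAlgebraic k l' := isAlgebraic_of_le hl'k
  have hl'L' : (IntermediateField.extendScalars hll' : IntermediateField l Ω) = L' := by
    apply IntermediateField.restrictScalars_injective k
    rw [IntermediateField.extendScalars_restrictScalars]
  have hA'le : A' ≤ (IntermediateField.extendScalars hll').toSubalgebra := by
    rw [hl'L', hL'A']
  suffices H : (IntermediateField.extendScalars hll').toSubalgebra.LinearDisjoint El.toSubalgebra from
    H.of_le_left_of_flat hA'le
  -- ### degrees are stationary above `l₀`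
  have hdl : d l = d l₀ := le_antisymm (hdmono hl₀l) (hmin l hl hlfin)
  have hdl' : d l' = d l := by
    rw [hdl]
    exact le_antisymm (hdmono (hl₀l.trans hll')) (hmin l' hl'k hl'fin)
  -- ### `l'(t)` and `lK` are linearly disjoint over `l(t)`, by counting degrees
  set Y' : IntermediateField Mt Ω := IntermediateField.adjoin Mt (l' : Set Ω) with hY'
  have hY'res : (Y'.restrictScalars l).restrictScalars k = M l' := by
    rw [hY', IntermediateField.restrictScalars_adjoin, IntermediateField.restrictScalars_adjoin]
    refine le_antisymm ?_ ?_
    · rw [IntermediateField.adjoin_le_iff]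
      rintro x (hx | hx | hx)
      · exact hlM l' (hll' hx)
      · exact hMmono hll' (hMt_res ▸ hx : x ∈ M l)
      · exact hlM l' hx
    · rw [hM l', IntermediateField.adjoin_le_iff]
      rintro x (hx | hx)
      · exact IntermediateField.subset_adjoin k _ (Or.inr (Or.inr hx))
      · rw [Set.mem_singleton_iff] at hx
        rw [hx]
        exact IntermediateField.subset_adjoin k _
          (Or.inr (Or.inl (IntermediateField.mem_adjoin_simple_self l t)))
  have hY'coe : (Y' : Set Ω) = (M l' : Set Ω) := by
    rw [← hY'res]
    rfl
  -- `l'(t)` is finite over `l(t)`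
  have hMl'eq : IntermediateField.extendScalars (hMmono hll') =
      IntermediateField.adjoin (M l) (l' : Set Ω) := by
    apply IntermediateField.restrictScalars_injective k
    rw [IntermediateField.extendScalars_restrictScalars, IntermediateField.restrictScalars_adjoin,
      IntermediateField.adjoin_union, IntermediateField.adjoin_self, IntermediateField.adjoin_self]
    exact (hMsup hll').symm
  haveI hMl'fin : FiniteDimensional (M l) (IntermediateField.extendScalars (hMmono hll')) := by
    rw [hMl'eq]
    have hr := IntermediateField.adjoin_rank_le_of_isAlgebraic (M l) l' (Or.inr alg_l')
    exact Module.rank_lt_aleph0_iff.mp (hr.trans_lt (Module.rank_lt_aleph0 k l'))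
  have hfinY' : Module.finrank Mt Y' = (M l).relfinrank (M l') := by
    rw [IntermediateField.relfinrank_eq_finrank_of_le (hMmono hll')]
    refine finrank_eq_of_coe_eq e he Y' _ ?_
    rw [hY'coe, IntermediateField.coe_extendScalars]
  have hmpos : 0 < (M l).relfinrank (M l') := by
    rw [IntermediateField.relfinrank_eq_finrank_of_le (hMmono hll')]
    exact Module.finrank_pos
  haveI : FiniteDimensional Mt Y' := Module.finite_of_finrank_pos (by rw [hfinY']; exact hmpos)
  clear hMl'fin
  -- `[l'K : l(t)] = [l'(t) : l(t)] · [lK : l(t)]`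
  have hsupcoe : ((Y' ⊔ X : IntermediateField Mt Ω) : Set Ω) = (EK l' : Set Ω) := by
    have h1 : (Y' ⊔ X).toSubfield = (EK l').toSubfield := by
      rw [IntermediateField.sup_toSubfield]
      have hY : Y'.toSubfield = (M l').toSubfield := by
        rw [← hY'res]
        rfl
      have hXs : X.toSubfield = (EK l).toSubfield := by
        rw [hX, IntermediateField.extendScalars_toSubfield, hEl,
          IntermediateField.extendScalars_toSubfield]
      rw [hY, hXs, ← IntermediateField.sup_toSubfield, hEKsup hll']
    exact congrArg (fun S : Subfield Ω => (S : Set Ω)) h1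
  have hfinsup : Module.finrank Mt (Y' ⊔ X : IntermediateField Mt Ω) =
      (M l).relfinrank (EK l') := by
    have hle : M l ≤ EK l' := (hMmono hll').trans (hME l')
    rw [IntermediateField.relfinrank_eq_finrank_of_le hle]
    refine finrank_eq_of_coe_eq e he _ _ ?_
    rw [hsupcoe, IntermediateField.coe_extendScalars]
  have hcount : Module.finrank Mt (Y' ⊔ X : IntermediateField Mt Ω) =
      Module.finrank Mt Y' * Module.finrank Mt X := by
    rw [hfinsup, hfinY', hfinX, ← IntermediateField.relfinrank_mul_relfinrank (hMmono hll') (hME l')]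
    show (M l).relfinrank (M l') * d l' = (M l).relfinrank (M l') * d l
    rw [hdl']
  have HLD : Y'.LinearDisjoint X := IntermediateField.LinearDisjoint.of_finrank_sup hcount
  -- ### transitivity through `l(t)`: `l'` and `lK` are linearly disjoint over `l`
  haveI : Algebra.IsAlgebraic l (IntermediateField.extendScalars hll') :=
    isAlgebraic_extend (kalg := kalg) _
      (by rw [IntermediateField.extendScalars_restrictScalars]; exact hl'k)
  have H1 : (IntermediateField.extendScalars hll').LinearDisjoint Mt :=
    linearDisjoint_adjoin_simple_of_transcendental _ htl
  have H2 : (IntermediateField.adjoin Mt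
      ((IntermediateField.extendScalars hll' : IntermediateField l Ω) : Set Ω)).LinearDisjoint X := by
    rw [IntermediateField.coe_extendScalars]
    exact HLD
  have HT := linearDisjoint_of_linearDisjoint_adjoin (IntermediateField.extendScalars hll') Mt X H1 H2
  exact linearDisjoint_restrict K l' hll' hMtEl HT

end CurveSmoothing

end Literature.AlgebraicGeometry.Resolution

end
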